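import Summits.NavierStokesRegularity.NavierStokesRegularity.Theses.FilamentSkeletonRss
import Summits.NavierStokesRegularity.NavierStokesRegularity.Theorems.CoreGluing.Negative.ThresholdLoadBearing
import Summits.NavierStokesRegularity.NavierStokesRegularity.Theorems.CoreGluing.Negative.ParallelLinesSubcritical
import Summits.NavierStokesRegularity.NavierStokesRegularity.Theorems.SkeletonEquilibrium.Negative.StrainIdentity
import Summits.NavierStokesRegularity.NavierStokesRegularity.Theorems.SkeletonEquilibrium.Negative.StraightLinesVertical
import Summits.NavierStokesRegularity.NavierStokesRegularity.Theorems.SkeletonEquilibrium.Negative.PlanarSubcritical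

/-!
# Disproof of `SkeletonEquilibrium` (stmt-NavierStokesRegularity-15400) — standing adversary's work file

cdisprove seat `refuter-cdisprove-stmt-NavierStokesRegularity-15400-0`, cycle 1 (2026-08-16).
`lean check` rc 0; `sorry` only in §(e) (near-misses, each with its obstruction). The sorry-free
material of §(a)–(c) is LANDED on the Negative lane and imported here:
`Theorems/SkeletonEquilibrium/Negative/StrainIdentity.lean` (p129276, this seat),
`Theorems/SkeletonEquilibrium/Negative/StraightLinesVertical.lean` (p129835, this seat),
`Theorems/SkeletonEquilibrium/Negative/PlanarSubcritical.lean` (p130021, this seat),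
`Theorems/CoreGluing/Negative/ThresholdLoadBearing.lean` and `…/ParallelLinesSubcritical.lean`
(sibling cdisprove seat of `CoreGluing`, whose hypothesis IS this crux).

## The crux (read-back)

`∃ (N γ α δ ρ K), N ≥ 1, α ≠ 0, δ, ρ > 0, γ_j ≠ 0, ∀ Γ₀ ∃ Γ ≥ Γ₀, Γ > 0, ∃ (Ξ_j : ℝ → ℝ³) (w_j : ℝ → ℝ)`:
C², injective, unit speed, `‖Ξ_j″‖√Γ ≤ K`, proper at both ends, pairwise `ρ√Γ`-separated, the
Rosenhead-regularised Biot–Savart integrand integrable at every point, the RELATIVE-EQUILIBRIUM system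
`u_skel(Ξ_j τ) + ½ Ξ_j τ − α e₃ × Ξ_j τ = w_j τ • Ξ_j′ τ` (core 1, circulations `Γγ_k`), and on every
filament a UNIQUE zero `τ*` of `w_j` with `3/2 + δ ≤ w_j′(τ*)` (SC). No junk: the Bochner integral is
guarded by the integrability clause, rpow bases `≥ 1`, `K ≥ 0` forced, head `∃∀∃` (a Γ-uniform family).
In waist units `X = Ξ/√Γ` the statement is: relative equilibria of O(1) circulations `γ_k` with core
`ε = Γ^{-1/2} → 0`, O(1) separation and curvature, in the frame `V_α y = ½y − αe₃×y`; `w_j′` is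
scale-free.

## Findings (index)

* (0) `WithThreshold c` — the crux VERBATIM with `3/2` replaced by `c`; `skeletonEquilibrium_iff`
  (`Iff.rfl`), `WithThreshold.mono`.
* (a) LOAD-BEARING ANALYSIS (existential crux: a clause is load-bearing iff deleting it makes the
  statement trivially true). `withThreshold_of_lt_half` [= landed
  `CoreGluing.Negative.skeletonEquilibrium_holds_below_drift`]: for EVERY `c < ½` the statement holds at
  every `Γ` with ONE vertical filament on the axis, `w = τ/2`. So C², injectivity, unit speed,
  curvature, properness, separation, integrability, the whole Biot–Savart equilibrium system and the
  unique zero are jointly FREE; the supercriticality inequality is THE load-bearing clause, tight at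
  `c = ½` (`CoreGluing.Negative.parallel_lines_drift`: every axis-parallel array has `w_j = ½(⟪p_j,e₃⟫+τ)`).
  There is no `_false_without_` lemma to write: dropping ANY other clause only weakens an already
  cheap remainder. (Mutations recorded: `α ≠ 0` dropped ⇒ still (SC) is the issue; `δ > 0` dropped ⇒
  the tail law of §(e2) says zeros on pure inverse-square tails have slope EXACTLY 3/2, so `δ = 0`
  might be reachable by far-tail zeros — the strict margin is meaningful, keep it.)
* (b) STRUCTURE EVERY WITNESS HAS [landed, `SkeletonEquilibrium.Negative.StrainIdentity`]:
  `strain_identity` / `witness_slope_eq`: from the per-filament clauses and the equilibrium system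
  ALONE, `u_skel ∘ Ξ_j` is differentiable and `w_j′ = ½ + ⟪(u_skel∘Ξ_j)′, Ξ_j′⟫` identically — Leray
  stretching gives exactly `½`, rotation and curvature nothing, and NOTHING about the kernel enters.
  `witness_axial_strain_ge`: (SC) ⟺ axial strain of the skeleton's own field `≥ 1 + δ` at `τ*`.
  `not_supercritical_of_zero_axial_strain`: axially constant induction ⇒ slope `½` ⇒ dead for every
  `c ≥ ½`. This one identity explains (a), the parallel arrays, §(c1) and the pure outer balance.
* (c) NATURAL STRENGTHENINGS REFUTED.
  (c1) [landed, `SkeletonEquilibrium.Negative.StraightLinesVertical`] STRAIGHT skeletons: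
  `norm_line_induction_le` (regularised induction of a straight filament is `≤ π` everywhere),
  `straight_lines_vertical` (all-affine + equilibrium system + `α ≠ 0` ⇒ every line vertical: the
  rotation's normal component `−ατ e₃×e_j` is unbounded, induction bounded),
  `straight_lines_slope_half` / `straight_lines_not_supercritical` (⇒ `w_j′ ≡ ½`, no threshold
  `c ≥ ½`). So the route's certified INNER data (2001 `C₃` triple / cages, the ideators' exact
  `C₄`/`C₃` rational data) are never witnesses at any `Γ`; bending to log-spiral ends is mandatory and
  the certified (SC) margin must survive it — that transfer IS the crux.
  (c2) [sibling, landed] VERTICAL ARRAYS (2-D relative equilibria, any `N`): `w′ ≡ ½`.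
  (c3) [landed, `SkeletonEquilibrium.Negative.PlanarSubcritical`] PLANAR horizontal skeletons:
  `planar_slope_half` / `planar_not_supercritical` — all filaments in `{z = 0}` ⇒ in-plane tangents ×
  in-plane chords are vertical ⇒ the induced velocity along each filament and its derivative are
  vertical ⇒ zero axial strain ⇒ `w_j′ ≡ ½`. With (c1), (c2) this exhausts the rigid/degenerate
  classes: a witness is a genuinely three-dimensional curved configuration.
  (c4) SYMMETRIC DATA CLASSES of the intended construction (numerics + a 5-line symmetry argument,
  this seat; files `compute/outer_geometry.py`, `d1_refine.py`, `zsign_scan.py`, `chirality_check.py`,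
  `c4_next_order.py`, attached as evidence): the leading-order OUTER curves (`η = 8π/(γ log Γ) → 0`,
  `Y = √η X`) solve `Y″ = Y′ × AY`, `A = ½ − αJ`, through the origin, and satisfy the EXACT identities
  `Y(−s) = −Y(s)` (oddness) and `R_π Y(−s) = σ_z Y(s)` (σ_z-reversibility: σ_z commutes with A, is
  improper, and `−R_π e = σ_z e`). Hence (i) any two filaments exchanged by the rotation `R_π` (every
  even-`N` orbit, 2001's 2-line case, the `C₄` datum of `rational-waist-certificate`) INTERSECT at
  leading order wherever `z(s)` changes sign along the outer curve — for the `C₄` datum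
  (`e₀ = (0,24/25,7/25)`, `α = 1.83`) at `s* = 0.98`; in every sampled case (N = 2,4,6; α = ±1, ±1.83,
  ±3; γ/2π = 1, 2, 3.2) the chirality giving a supercritical inner zero is the chirality with the sign
  change; (ii) two filaments exchanged by `−I` (inversion-symmetric cages of
  `polynomial-stagnation-certificate`) COINCIDE at leading order along their whole length.
  NOT A KILL, and weaker than 2001 feared: at next order (one Picard step with waist offsets and frozen
  mutual induction, `η = 0.04 … 6·10⁻⁴`) the `C₄` pair passes the crossing zone at distance → 2.26
  WAIST units (> waist separation 2.0 > the card's ρ = 0.539), i.e. the leading-order crossing is an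
  `o(radius)` approach but an O(√Γ) miss — exactly what the crux's separation clause `ρ√Γ` tolerates.
  Consequences recorded for the line: "images approach within o(radius)" is NOT a kill criterion for
  the crux; even-N / inversion-symmetric data need the next-order offset checked along the whole
  coincidence set (for `−I` pairs: everywhere), odd single orbits (`C₃`, `C₅`) do not
  (D2: ≥ 0.18 r, D3: ≥ 0.67 r at leading order).
* (d) TARGETS. Payload `line = null`, `stuck_stubs = []`, but during this cycle the lead PICKED the line
  `Sketch` (`PICKED.md`, `Lines/Sketch.lean`, `Lines/SketchTools.lean`): C₄ orbit of `P₀ = (1,0,−10)`,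
  `e₀ = (0,4/5,3/5)`, `γ ≡ 16π`, `α = −5/8`; stubs `stub_innerCertificate` (landed), `stub_persistence`
  (landed), `stub_transfer` (open, XL), tools `stub_lineBiotSavart`, `stub_outerSlopeHalf`,
  `stub_stretchingIdentity`. Attacked here: (d1) the model slip `W` of the skeleton agrees with the
  independently derived inner model to 1e-15 at 11 points; unique real zero `t* = −2.65341`,
  `W′(t*) = 2.8119`, no other sign change on `[−60, 60]` (`compute/lead_datum_check.py`) — certificate
  consistent. (d2) chirality: by the exact mirror identity of (c4) the R_π-partners of this even orbit
  meet at leading order iff `z` changes sign along the outer curve; for `α = −5/8` it does NOT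
  (`z ≥ 0.6 s` near 0, end cones `z/r → ±2.089`, images `≥ 0.48|Y|`), for `α = +5/8` it DOES (exact
  crossing at `s = 5.15`) — the lead's choice is the right one and is now explained by a theorem-shaped
  identity rather than a scan (`compute/lead_outer_check.py`). (d3) tools stubs are TRUE: T3 is the landed
  `strain_identity` plus the chain rule (proof attached as item evidence `T3_from_StrainIdentity.lean`),
  T2 is `⟨Y″,AY⟩ = 0`, `⟨AT,T⟩ = ½`, `|AY| ≤ √(¼+α²)|Y|`, T1 is `∫((d²+1+s²)^{3/2})⁻¹ = 2/(d²+1)`.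
  (d4) `stub_transfer` as typed is consistent (parameter origin free per filament; `w ≠ 0` for
  `|t| ≥ 10` matches `W ≈ t/2 − 5/2` there and the slope-½ law beyond; ρ, K may depend on ε) and is
  the crux at this datum: it inherits the resistance below; nothing cheap bites it. Not a target kill.
* (e) NEAR-MISSES (sorried below, with obstruction): (e2) the tail law
  `w_j′ → ½` at both ends of every witness (would confine `τ*` to the waist; needs decay of the axial
  Biot–Savart strain along proper separated ends — differentiation under the regularised integral plus
  a far-field estimate for ARBITRARY admissible geometry of the other filaments, not cheap);
  (e3) `N = 1` is heuristically dead (self-strain `≥ 1+δ` needs a part of the same filament at O(1)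
  waist distance, but O(1) curvature costs binormal speed O(log Γ) against an O(1) drift; a U-turn is
  only affordable at radius ≳ √(log Γ) with turning radius ≳ √(log Γ)) — needs the LIA asymptotics of
  the Rosenhead kernel, not in tree.

## Why the crux resists disproof (for the provers)

A disproof is a ROTATING-FRAME HORMOZ–BRENNER THEOREM: "every relative equilibrium of the regularised
Biot–Savart law in the frame `V_α` has axial induced strain `≤ 1` at each stagnation point on each
filament" (by (b) this is exactly `w′(τ*) ≤ 3/2`). Nothing in sight proves it: (i) the identity (b) is
blind to the kernel, and the kernel CAN produce axial strain `> 1` — the Γ → ∞ inner model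
`W_j = t/2 + c_j + Σ_k (γ_k/2π) m_jk/q_jk(t)` (re-derived independently here, `compute/inner_check.py`,
reproducing the `C₄` datum `t* = −1.74679, W′ = 3.6348, c₀ = −1098/625` and the θ = 45° datum
`t* = −0.28427, W′ = 2.8403` of two other seats) has unique supercritical zeros with margin, certified
EXACTLY over ℚ by the ideators; (ii) `div(u_skel + V_α) = 3/2` only says the two transverse
eigenvalues at `τ*` have real parts summing to `3/2 − w′ < 0` (a transversally attracting
saddle-focus, consistent); (iii) index theory: each on-filament zero has index +1 and `u_skel + V_α`
has total index +1, so a witness with `N` filaments carries `≥ N − 1` further stagnation points OFF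
the skeleton (on the axis for `C_N` data) — a feature, not a contradiction; (iv) virial/energy
identities are flux-dominated on infinite filaments; (v) the far field is benign: ends align with
`V_α` (log-spirals on cones `z = c·r`, curvature ~ 1/|x|, kernel integrable since `|Ξ(σ)| ~ σ`),
different cones meet only at the apex, images on a common cone separate linearly EXCEPT at the
symmetric leading-order coincidences of (c4), which the O(√Γ) separation clause tolerates;
(vi) no printed non-existence theorem (searches: local index DOWN this session, crossref sweep:
Hormoz–Brenner 2012 numerics non-rotating, Kimura 2009, Klein–Majda 1991, Pelz 1997,
Kallyadan–Shukla PRFluids 2022 — none a theorem against; `ledger negatives`, `Theorems/*Refutation`,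
the barrier catalogue: nothing bites a finite-dimensional filament-tangency statement).
So the truth of the crux is the truth of a perturbation theorem (certified straight data + bending at
relative size `1/log Γ` + Fredholm/IVP control along spiral ends); the adversary's contribution is the
exact shape of what must be transported ((b): an axial-strain margin), the death of every rigid class
((a), (c1), (c2)), and the symmetric-data caveat (c4).
-/

set_option linter.dupNamespace false

namespace Summit.NavierStokesRegularity.NavierStokesRegularity.Cruxes.SkeletonEquilibrium.Disproof

open scoped RealInnerProductSpace InnerProductSpace BigOperators
open Literature.Analysis.FluidPDE MeasureTheory Filter
open Summit.NavierStokesRegularity.NavierStokesRegularity.Theorems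

/-! ## (0) The crux with the stretching threshold as a parameter -/

/-- The crux `SkeletonEquilibrium` VERBATIM except that the supercriticality threshold `3/2` in the
last clause `3/2 + δ ≤ w_j′(τ*)` is replaced by a parameter `c`; `SkeletonEquilibrium` is
`WithThreshold (3/2)` definitionally (`skeletonEquilibrium_iff`). (The sibling workfile
`Cruxes/CoreGluing/Disproof.lean` calls the same family `SkeletonEquilibriumAt`.) -/
def WithThreshold (c : ℝ) : Prop :=
  ∃ (N : ℕ) (γ : Fin N → ℝ) (α δ ρ K : ℝ), 0 < N ∧ α ≠ 0 ∧ 0 < δ ∧ 0 < ρ ∧ (∀ j, γ j ≠ 0) ∧ ∀ Γ₀ : ℝ, ∃ Γ : ℝ, Γ₀ ≤ Γ ∧ 0 < Γ ∧ ∃ (Ξ : Fin N → ℝ → EuclideanSpace ℝ (Fin 3)) (w : Fin N → ℝ → ℝ), (∀ j, ContDiff ℝ 2 (Ξ j) ∧ Function.Injective (Ξ j) ∧ Differentiable ℝ (w j) ∧ (∀ τ, ‖deriv (Ξ j) τ‖ = 1) ∧ (∀ τ, ‖iteratedDeriv 2 (Ξ j) τ‖ * Real.sqrt Γ ≤ K)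 ∧ Filter.Tendsto (fun τ => ‖Ξ j τ‖) Filter.atTop Filter.atTop ∧ Filter.Tendsto (fun τ => ‖Ξ j τ‖) Filter.atBot Filter.atTop) ∧ (∀ j k, j ≠ k → ∀ τ σ, ρ * Real.sqrt Γ ≤ ‖Ξ j τ - Ξ k σ‖) ∧ (∀ j (x : EuclideanSpace ℝ (Fin 3)), MeasureTheory.Integrable (fun σ : ℝ => ((‖x - Ξ j σ‖ ^ 2 + 1) ^ (3 / 2 : ℝ))⁻¹ • Literature.Analysis.FluidPDE.cross (deriv (Ξ j) σ) (x - Ξ j σ))) ∧ (∀ j τ, (∑ k : Fin N, (Γ * γ k / (4 * Real.pi)) • ∫ σ : ℝ, ((‖Ξ j τ - Ξ k σ‖ ^ 2 + 1) ^ (3 / 2 : ℝ))⁻¹ • Literature.Analysis.FluidPDE.cross (deriv (Ξ k) σ) (Ξ j τ - Ξ k σ)) + (1 / 2 : ℝ) • Ξ j τ - α • Literature.Analysis.FluidPDE.cross (EuclideanSpace.single (2 : Fin 3) (1 : ℝ)) (Ξ j τ) = w j τ • deriv (Ξ j) τ) ∧ (∀ j, ∃ τs : ℝ, w j τs = 0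 ∧ (∀ τ, w j τ = 0 → τ = τs) ∧ c + δ ≤ deriv (w j) τs)

/-- The crux is the threshold family at `c = 3/2`, definitionally. -/
theorem skeletonEquilibrium_iff :
    Summit.NavierStokesRegularity.NavierStokesRegularity.Theses.FilamentSkeletonRss.SkeletonEquilibrium ↔
      WithThreshold (3 / 2) :=
  Iff.rfl

/-- Monotonicity of the family in the threshold. -/
theorem WithThreshold.mono {c c' : ℝ} (h : c' ≤ c) (hc : WithThreshold c) : WithThreshold c' := by
  obtain ⟨N, γ, α, δ, ρ, K, hN, hα, hδ, hρ, hγ, hfam⟩ := hc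
  refine ⟨N, γ, α, δ, ρ, K, hN, hα, hδ, hρ, hγ, fun Γ₀ => ?_⟩
  obtain ⟨Γ, hΓ₀, hΓ, Ξ, w, h1, h2, h3, h4, h5⟩ := hfam Γ₀
  refine ⟨Γ, hΓ₀, hΓ, Ξ, w, h1, h2, h3, h4, fun j => ?_⟩
  obtain ⟨τs, hz, huniq, hsc⟩ := h5 j
  exact ⟨τs, hz, huniq, by linarith⟩

/-! ## (a) Load-bearing analysis: everything except (SC) is free -/

/-- **(SC) is the load-bearing clause** (re-export of the landed
`CoreGluing.Negative.skeletonEquilibrium_holds_below_drift`, whose inline statement is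
`WithThreshold c` verbatim): for every threshold `c < ½` the crux-with-threshold-`c` holds, at every
`Γ`, with the single vertical filament `Ξ(τ) = τ e₃`, `w = τ/2`. -/
theorem withThreshold_of_lt_half {c : ℝ} (hc : c < 1 / 2) : WithThreshold c :=
  CoreGluing.Negative.skeletonEquilibrium_holds_below_drift hc

/-! ## (b) The strain identity — landed: `SkeletonEquilibrium.Negative.StrainIdentity`
(`strain_identity`, `witness_slope_eq`, `witness_axial_strain_ge`,
`not_supercritical_of_zero_axial_strain`; imported above). -/

/-! ## (c) Natural strengthenings refuted — landed: `SkeletonEquilibrium.Negative.StraightLinesVertical`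
(`norm_line_induction_le`, `straight_lines_vertical`, `straight_lines_slope_half`,
`straight_lines_not_supercritical`), `SkeletonEquilibrium.Negative.PlanarSubcritical`
(`planar_slope_half`, `planar_not_supercritical`), `CoreGluing.Negative.ParallelLinesSubcritical`
(`parallel_lines_drift`, `parallel_lines_not_supercritical`); all imported above. The symmetric-data
numerics of (c4) are in the evidence files `SYMMETRIC-DATA-c1.md` / `compute-bundle-cdisprove-c1.txt`. -/

/-- (c) sanity re-statement through the imports: no straight configuration is supercritical. -/
example {N : ℕ} (γ : Fin N → ℝ) {α : ℝ} (hα : α ≠ 0) (Γ : ℝ) {c δ : ℝ} (hc : 1 / 2 ≤ c)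
    (hδ : 0 < δ) (a e : Fin N → EuclideanSpace ℝ (Fin 3)) (he : ∀ k, ‖e k‖ = 1)
    (Ξ : Fin N → ℝ → EuclideanSpace ℝ (Fin 3)) (hΞ : ∀ k, Ξ k = fun τ => a k + τ • e k)
    (w : Fin N → ℝ → ℝ)
    (heq : ∀ j τ, (∑ k : Fin N, (Γ * γ k / (4 * Real.pi)) • ∫ σ : ℝ,
      ((‖Ξ j τ - Ξ k σ‖ ^ 2 + 1) ^ (3 / 2 : ℝ))⁻¹ • cross (deriv (Ξ k) σ) (Ξ j τ - Ξ k σ)) +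
      (1 / 2 : ℝ) • Ξ j τ - α • cross (EuclideanSpace.single (2 : Fin 3) (1 : ℝ)) (Ξ j τ) =
      w j τ • deriv (Ξ j) τ)
    (j : Fin N) (τs : ℝ) : ¬ (c + δ ≤ deriv (w j) τs) :=
  SkeletonEquilibrium.Negative.straight_lines_not_supercritical γ hα Γ hc hδ a e he Ξ hΞ w heq j τs

/-! ## (e) Near-misses (the ONLY sorries of this file) -/

/-- (e2) TAIL LAW (conjectured structure of every witness): the slope tends to the Leray rate at both
ends, `w_j′(τ) → ½` as `τ → ±∞`, so supercritical zeros live at the waist. Obstruction: needs the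
axial Biot–Savart strain `⟪(u_skel∘Ξ_j)′, Ξ_j′⟫ → 0` along a proper separated end for ARBITRARY
admissible geometry of the other filaments (differentiation under the regularised integral is fine —
the kernel is smooth — but the decay needs a far-field estimate, and the clauses ALONE do not give it:
properness + `ρ√Γ`-separation + curvature `≤ K/√Γ` still allow another filament to accumulate length
near this end (dense coils of radius `≥ √Γ/K` at distance `≥ ρ√Γ`), so the estimate must use the
equilibrium system of the OTHER filaments as well — a genuinely coupled far-field lemma). -/
theorem tail_slope_tendsto_half {N : ℕ} (γ : Fin N → ℝ) (α Γ ρ K : ℝ) (hρ : 0 < ρ) (hΓ : 0 < Γ)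
    (Ξ : Fin N → ℝ → EuclideanSpace ℝ (Fin 3)) (w : Fin N → ℝ → ℝ)
    (hfil : ∀ j, ContDiff ℝ 2 (Ξ j) ∧ Function.Injective (Ξ j) ∧ Differentiable ℝ (w j) ∧
      (∀ τ, ‖deriv (Ξ j) τ‖ = 1) ∧ (∀ τ, ‖iteratedDeriv 2 (Ξ j) τ‖ * Real.sqrt Γ ≤ K) ∧
      Filter.Tendsto (fun τ => ‖Ξ j τ‖) Filter.atTop Filter.atTop ∧
      Filter.Tendsto (fun τ => ‖Ξ j τ‖) Filter.atBot Filter.atTop)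
    (hsep : ∀ j k, j ≠ k → ∀ τ σ, ρ * Real.sqrt Γ ≤ ‖Ξ j τ - Ξ k σ‖)
    (hint : ∀ j (x : EuclideanSpace ℝ (Fin 3)), MeasureTheory.Integrable (fun σ : ℝ =>
      ((‖x - Ξ j σ‖ ^ 2 + 1) ^ (3 / 2 : ℝ))⁻¹ • cross (deriv (Ξ j) σ) (x - Ξ j σ)))
    (heq : ∀ j τ, (∑ k : Fin N, (Γ * γ k / (4 * Real.pi)) • ∫ σ : ℝ,
      ((‖Ξ j τ - Ξ k σ‖ ^ 2 + 1) ^ (3 / 2 : ℝ))⁻¹ • cross (deriv (Ξ k) σ) (Ξ j τ - Ξ k σ)) +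
      (1 / 2 : ℝ) • Ξ j τ - α • cross (EuclideanSpace.single (2 : Fin 3) (1 : ℝ)) (Ξ j τ) =
      w j τ • deriv (Ξ j) τ)
    (j : Fin N) :
    Filter.Tendsto (fun τ => deriv (w j) τ) Filter.atTop (nhds (1 / 2)) ∧
      Filter.Tendsto (fun τ => deriv (w j) τ) Filter.atBot (nhds (1 / 2)) := by
  sorry

end Summit.NavierStokesRegularity.NavierStokesRegularity.Cruxes.SkeletonEquilibrium.Disproof
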